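import Mathlib
import Literature.MathematicalPhysics.QuantumFieldTheory.Balaban1983to89.B9SectDL2Decay

/-!
# `Balaban1983to89.B9SectDWeightedNeumann` — [Balaban1985BackgroundPropagators] Sect. D, the Neumann series (3.130)
in the WEIGHTED ROW-SUM NORM: the decay rate is lost ONCE (σ), not twice — a kernel-checked sharpening of the
bookkeeping of `…B9SectDL2Decay.rightEntry_majorant`, recorded by the adversarial reader 1 (cell GAPS G-A21-1 (ii),
C-A22-1 / G-A22-1); v1.1 = docstring-only DOCFIX (quotation of (3.130) closed where the print ends, p. 422 exception clause added)

CITATION HEADER (lean-in-tree rule 2026-08-18).  Source under reading: T. Bałaban, *Propagators for lattice gauge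
theories in a background field*, Commun. Math. Phys. **99**, 389–434 (1985), doi:10.1007/bf01240355
[`Balaban1985BackgroundPropagators`] (cell paper B9; journal page = PDF page + 388), and T. Bałaban, *Propagators and
renormalization transformations for lattice gauge theories. II*, Commun. Math. Phys. **96**, 223–250 (1984)
[`Balaban1984PropagatorsII`] (cell paper B6 = ref. [4] of B9).  PRINTED INPUTS (statements only): (3.130) p. 421:
*"From (3.120) we get G = G₀(I − Δ′_πG₀)⁻¹ = Σ_{n=0}^∞ G₀(Δ′_πG₀)ⁿ. (3.130)"* (the display ENDS there; the expansion
G₀ + G₀Δ′_πG₀ + ⋯ used below is the n = 0, 1 terms of that sum, not a printed identity — DOCFIX v1.1 after XREAD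
C-pv27-21 R1 = G-pv10-10 V3); p. 422 after (3.131): *"This inequality and Theorem 3.3 for G₀ imply a convergence of
the series (3.130), for α₀ sufficiently small, in all norms appearing on the left-hand sides of the inequalities
(3.42)–(3.47), except the inequality involving the Laplace operator in (3.42). Thus we have Theorem 3.3. for G, with
this exception."*; p. 423, the Hölder display for the terms of
(3.138) ending in *"e^{−(1−α)δ₀d(y,y′)}O(1)Mα₀(L^{j′}η)^{−2}|A|"* and, after Theorem 3.12: *"Let us denote a common,
best possible, decay rate for all these operators by δ₀. It is a positive, absolute constant depending on d and L
only."*; [4] Lemma 2.1 (2.54) p. 233 (the triangle inequality for the multiscale distance d, `B6RandomWalk.Triangle254`)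
and (2.61) p. 234 (the row sum, `B11SectG.RowSum`).

WHAT IS REPRODUCED.  The landed module `…B9SectDL2Decay` renders the Neumann bookkeeping of (3.130) over abstract
block majorants (`B11SectG.HasMaj`): `rightEntry_majorant` needs ρ + 2σ ≤ δ₁ and q = κ₂κ₁Bθc(σ)² < 1 — the rate σ is
paid once for the composition K′ = G₀T′ and once more inside the Neumann series (`B11SectG.neumann_majorant`), both
through the convolution estimate `B11SectG.conv_exp_le`.  The cell's adversarial reader (GAPS G-A21-1 (ii)) remarked that
running the same argument in the weighted row-sum norm ‖N‖_ρ := sup_y Σ_{y′} N(y,y′)e^{ρd(y,y′)} loses the rate ONLY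
ONCE.  This module makes that remark KERNEL, over the same vocabulary and with nothing re-typed:

* `WRow g ρ N M` — the weighted row-sum bound ‖N‖_ρ ≤ M for a majorant kernel N ≥ 0 on 𝔅 × 𝔅;
* `wrow_conv` — SUBMULTIPLICATIVITY: ‖N₁ ∗_κ N₂‖_ρ ≤ κ‖N₁‖_ρ‖N₂‖_ρ for the 𝔅-convolution Σ_{y″}N₁(y,y″)κN₂(y″,y′)
  of `B11SectG.hasMaj_comp` (one use of the triangle inequality (2.54) per composition, NO row sum);
* `wrow_of_exp` — the only place a row sum enters: θe^{−δd} has ‖·‖_ρ ≤ θc whenever ρ + σ ≤ δ and `RowSum g σ c`;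
* `conv_wrow_exp` — Σ_{y″}N(y,y″)e^{−ρd(y″,y′)} ≤ ‖N‖_ρ e^{−ρd(y,y′)}: a weighted-norm kernel composed with a
  rate-ρ majorant keeps the rate ρ EXACTLY;
* `neumann_majorant_wrow` — the Neumann series (3.130)/(188) for K′ given ONLY by its weighted-norm bound m: if
  q := κ₂m < 1 then 𝔄₀ = S + K′𝔄₀ has majorant A(1 − q)⁻¹e^{−ρd} — rate ρ of S preserved, no margin at all;
* `rightEntry_majorant_wrow` — the sharpened form of `B9SectDL2Decay.rightEntry_majorant`: G₀ and T′ = Δ′_π with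
  exp-majorants at rate δ₁, ρ + σ ≤ δ₁ (ONE σ), q = κ₂·(κ₁Bθc)·c — the same power c² as before, because ‖G₀‖_ρ ≤ Bc
  and ‖T′‖_ρ ≤ θc each need the row sum once (G-A22-1: the reader's remark claimed «q ∝ c, not c²» — true only when
  G₀ carries its OWN weighted-norm bound, e.g. G₀ = I in the reader's toy; `rightEntry_majorant_wrow'` is that variant,
  q = κ₂κ₁m_Gθc);
* an `example` (no new declaration) — specialising K′ to an exp-majorant reproduces `B11SectG.neumann_majorant`
  exactly (same q = κθc, same ρ + σ ≤ δ), so the weighted-norm lemma is a strict generalisation, not a rival.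

WHAT IS NOT CLAIMED.  Nothing about the operators themselves: G₀, T′, their majorants and the a priori bound are
hypotheses, exactly as in `…B9SectDL2Decay`; the print's "α₀ sufficiently small" is the explicit q < 1.  The loss σ
itself is intrinsic (GAPS G-A21-1 (i): the exact ℤ-witness shows the resolvent of a rate-δ kernel has rate < δ for
every q > 0), so no version of this bookkeeping recovers Theorem 3.1's δ₀ for G — the print's p. 423 redefinition of
δ₀ stands.  Value = kernel certificate + corrected constant, NOT summit progress.
-/

namespace Literature.MathematicalPhysics.QuantumFieldTheory.Balaban1983to89.B9SectDWeightedNeumann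

open Literature.MathematicalPhysics.QuantumFieldTheory.Balaban1983to89
open Finset B6RandomWalk B11SectG B9SectDL2Decay

variable {g : B6.Geometry}

/-! ## 1. The weighted row-sum norm -/

/-- ‖N‖_ρ ≤ M: *weighted row-sum bound* of a majorant kernel N on 𝔅 × 𝔅 at the rate ρ —
sup_y Σ_{y′} N(y,y′)e^{ρd(y,y′)} ≤ M. For N = θe^{−δd} and ρ + σ ≤ δ this is the row sum (2.61) of [4] Lemma 2.1 at the
rate σ (`wrow_of_exp`). [cite: Balaban1984PropagatorsII, (2.61) p.234] -/
def WRow (g : B6.Geometry) (ρ : ℝ) (N : g.Site → g.Site → ℝ) (M : ℝ) : Prop :=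
  ∀ y : g.Site, ∑ y' : g.Site, N y y' * Real.exp (ρ * g.dist y y') ≤ M

/-- Monotone in the kernel. [folklore] -/
theorem WRow.mono {ρ M : ℝ} {N N' : g.Site → g.Site → ℝ} (h : WRow g ρ N' M) (hle : ∀ a b, N a b ≤ N' a b) :
    WRow g ρ N M := fun y =>
  (Finset.sum_le_sum fun y' _ => mul_le_mul_of_nonneg_right (hle y y') (Real.exp_nonneg _)).trans (h y)

/-- Monotone in the bound. [folklore] -/
theorem WRow.le {ρ M M' : ℝ} {N : g.Site → g.Site → ℝ} (h : WRow g ρ N M) (hM : M ≤ M') : WRow g ρ N M' :=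
  fun y => (h y).trans hM

/-- The bound is non-negative as soon as 𝔅 is non-empty and N ≥ 0. [folklore] -/
theorem WRow.nonneg {ρ M : ℝ} {N : g.Site → g.Site → ℝ} (hN : ∀ x y, 0 ≤ N x y) (h : WRow g ρ N M)
    (y : g.Site) : 0 ≤ M :=
  (Finset.sum_nonneg fun y' _ => mul_nonneg (hN y y') (Real.exp_nonneg _)).trans (h y)

/-- POINTWISE DECAY from the weighted norm: N(y,y′) ≤ M e^{−ρd(y,y′)} (one term of the row sum). [folklore] -/
theorem WRow.pointwise {ρ M : ℝ} {N : g.Site → g.Site → ℝ} (hN : ∀ x y, 0 ≤ N x y) (h : WRow g ρ N M)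
    (y y' : g.Site) : N y y' ≤ M * Real.exp (-(ρ * g.dist y y')) := by
  have hterm : N y y' * Real.exp (ρ * g.dist y y') ≤ M :=
    (Finset.single_le_sum (f := fun y'' => N y y'' * Real.exp (ρ * g.dist y y''))
      (fun y'' _ => mul_nonneg (hN y y'') (Real.exp_nonneg _)) (Finset.mem_univ y')).trans (h y)
  have hpos : 0 < Real.exp (ρ * g.dist y y') := Real.exp_pos _
  rw [Real.exp_neg]
  calc N y y' = N y y' * Real.exp (ρ * g.dist y y') * (Real.exp (ρ * g.dist y y'))⁻¹ := by
        field_simp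
    _ ≤ M * (Real.exp (ρ * g.dist y y'))⁻¹ := mul_le_mul_of_nonneg_right hterm (inv_nonneg.mpr hpos.le)

/-- THE ONLY ENTRY OF THE ROW SUM: an exponential majorant θe^{−δd} has ‖·‖_ρ ≤ θc whenever ρ + σ ≤ δ and the row sum
(2.61) holds at rate σ with constant c. [cite: Balaban1984PropagatorsII, Lemma 2.1 (2.61) p.234] -/
theorem wrow_of_exp {θ δ ρ σ c : ℝ} (hd : ∀ a b : g.Site, 0 ≤ g.dist a b) (hrow : RowSum g σ c) (hθ : 0 ≤ θ)
    (hρδ : ρ + σ ≤ δ) :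
    WRow g ρ (fun a b => θ * Real.exp (-(δ * g.dist a b))) (θ * c) := by
  intro y
  have hterm : ∀ y' : g.Site,
      θ * Real.exp (-(δ * g.dist y y')) * Real.exp (ρ * g.dist y y') ≤ θ * Real.exp (-(σ * g.dist y y')) := by
    intro y'
    rw [mul_assoc, ← Real.exp_add]
    refine mul_le_mul_of_nonneg_left (Real.exp_le_exp.mpr ?_) hθ
    have := mul_le_mul_of_nonneg_right hρδ (hd y y')
    nlinarith
  calc ∑ y' : g.Site, θ * Real.exp (-(δ * g.dist y y')) * Real.exp (ρ * g.dist y y')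
      ≤ ∑ y' : g.Site, θ * Real.exp (-(σ * g.dist y y')) := Finset.sum_le_sum fun y' _ => hterm y'
    _ = θ * ∑ y' : g.Site, Real.exp (-(σ * g.dist y y')) := by rw [Finset.mul_sum]
    _ ≤ θ * c := mul_le_mul_of_nonneg_left (hrow y) hθ

/-- SUBMULTIPLICATIVITY under the 𝔅-convolution of `B11SectG.hasMaj_comp` (cutting cost κ of the intermediate
space): ‖N₁ ∗_κ N₂‖_ρ ≤ κ‖N₁‖_ρ‖N₂‖_ρ.  Uses the triangle inequality (2.54) once and NO row sum.
[cite: Balaban1984PropagatorsII, (2.54) p.233] -/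
theorem wrow_conv {ρ κ M₁ M₂ : ℝ} {N₁ N₂ : g.Site → g.Site → ℝ} (htri : Triangle254 g) (hρ : 0 ≤ ρ) (hκ : 0 ≤ κ)
    (hN₁ : ∀ x y, 0 ≤ N₁ x y) (hN₂ : ∀ x y, 0 ≤ N₂ x y) (hM₂ : 0 ≤ M₂)
    (h₁ : WRow g ρ N₁ M₁) (h₂ : WRow g ρ N₂ M₂) :
    WRow g ρ (fun a b => ∑ y'' : g.Site, N₁ a y'' * (κ * N₂ y'' b)) (κ * M₁ * M₂) := by
  intro y
  -- e^{ρd(y,y′)} ≤ e^{ρd(y,y″)}e^{ρd(y″,y′)}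
  have hexp : ∀ y'' y' : g.Site,
      Real.exp (ρ * g.dist y y') ≤ Real.exp (ρ * g.dist y y'') * Real.exp (ρ * g.dist y'' y') := by
    intro y'' y'
    rw [← Real.exp_add]
    refine Real.exp_le_exp.mpr ?_
    have := mul_le_mul_of_nonneg_left (htri y y'' y') hρ
    linarith [mul_add ρ (g.dist y y'') (g.dist y'' y')]
  calc ∑ y' : g.Site, (∑ y'' : g.Site, N₁ y y'' * (κ * N₂ y'' y')) * Real.exp (ρ * g.dist y y')
      = ∑ y'' : g.Site, ∑ y' : g.Site, N₁ y y'' * (κ * N₂ y'' y') * Real.exp (ρ * g.dist y y') := by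
        rw [Finset.sum_comm]
        exact Finset.sum_congr rfl fun y'' _ => by rw [Finset.sum_mul]
    _ ≤ ∑ y'' : g.Site, ∑ y' : g.Site,
          N₁ y y'' * Real.exp (ρ * g.dist y y'') * (κ * (N₂ y'' y' * Real.exp (ρ * g.dist y'' y'))) := by
        refine Finset.sum_le_sum fun y'' _ => Finset.sum_le_sum fun y' _ => ?_
        have hnn : 0 ≤ N₁ y y'' * (κ * N₂ y'' y') := mul_nonneg (hN₁ _ _) (mul_nonneg hκ (hN₂ _ _))
        calc N₁ y y'' * (κ * N₂ y'' y') * Real.exp (ρ * g.dist y y')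
            ≤ N₁ y y'' * (κ * N₂ y'' y') * (Real.exp (ρ * g.dist y y'') * Real.exp (ρ * g.dist y'' y')) :=
              mul_le_mul_of_nonneg_left (hexp y'' y') hnn
          _ = N₁ y y'' * Real.exp (ρ * g.dist y y'') * (κ * (N₂ y'' y' * Real.exp (ρ * g.dist y'' y'))) := by
              ring
    _ = ∑ y'' : g.Site, N₁ y y'' * Real.exp (ρ * g.dist y y'') *
          (κ * ∑ y' : g.Site, N₂ y'' y' * Real.exp (ρ * g.dist y'' y')) := by
        refine Finset.sum_congr rfl fun y'' _ => ?_
        rw [Finset.mul_sum, Finset.mul_sum]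
    _ ≤ ∑ y'' : g.Site, N₁ y y'' * Real.exp (ρ * g.dist y y'') * (κ * M₂) := by
        refine Finset.sum_le_sum fun y'' _ => ?_
        exact mul_le_mul_of_nonneg_left (mul_le_mul_of_nonneg_left (h₂ y'') hκ)
          (mul_nonneg (hN₁ _ _) (Real.exp_nonneg _))
    _ = (∑ y'' : g.Site, N₁ y y'' * Real.exp (ρ * g.dist y y'')) * (κ * M₂) := by rw [Finset.sum_mul]
    _ ≤ M₁ * (κ * M₂) := mul_le_mul_of_nonneg_right (h₁ y) (mul_nonneg hκ hM₂)
    _ = κ * M₁ * M₂ := by ring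

/-- RATE PRESERVED EXACTLY: a kernel with ‖N‖_ρ ≤ M composed (𝔅-convolution, cost κ) with the rate-ρ majorant
a·e^{−ρd} is bounded by κMa·e^{−ρd(y,y′)} — no margin σ, no row sum. [cite: Balaban1984PropagatorsII, (2.54) p.233] -/
theorem conv_wrow_exp {ρ κ M a₀ : ℝ} {N : g.Site → g.Site → ℝ} (htri : Triangle254 g) (hρ : 0 ≤ ρ) (hκ : 0 ≤ κ)
    (ha : 0 ≤ a₀) (hN : ∀ x y, 0 ≤ N x y) (h : WRow g ρ N M) (y y' : g.Site) :
    ∑ y'' : g.Site, N y y'' * (κ * (a₀ * Real.exp (-(ρ * g.dist y'' y')))) ≤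
      κ * M * a₀ * Real.exp (-(ρ * g.dist y y')) := by
  have hterm : ∀ y'' : g.Site,
      N y y'' * (κ * (a₀ * Real.exp (-(ρ * g.dist y'' y')))) ≤
        N y y'' * Real.exp (ρ * g.dist y y'') * (κ * a₀ * Real.exp (-(ρ * g.dist y y'))) := by
    intro y''
    have hE : Real.exp (-(ρ * g.dist y'' y')) ≤ Real.exp (ρ * g.dist y y'') * Real.exp (-(ρ * g.dist y y')) := by
      rw [← Real.exp_add]
      refine Real.exp_le_exp.mpr ?_
      have := mul_le_mul_of_nonneg_left (htri y y'' y') hρ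
      linarith [mul_add ρ (g.dist y y'') (g.dist y'' y')]
    calc N y y'' * (κ * (a₀ * Real.exp (-(ρ * g.dist y'' y'))))
        ≤ N y y'' * (κ * (a₀ * (Real.exp (ρ * g.dist y y'') * Real.exp (-(ρ * g.dist y y'))))) := by
          refine mul_le_mul_of_nonneg_left (mul_le_mul_of_nonneg_left (mul_le_mul_of_nonneg_left hE ha) hκ)
            (hN _ _)
      _ = N y y'' * Real.exp (ρ * g.dist y y'') * (κ * a₀ * Real.exp (-(ρ * g.dist y y'))) := by ring
  calc ∑ y'' : g.Site, N y y'' * (κ * (a₀ * Real.exp (-(ρ * g.dist y'' y'))))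
      ≤ ∑ y'' : g.Site, N y y'' * Real.exp (ρ * g.dist y y'') * (κ * a₀ * Real.exp (-(ρ * g.dist y y'))) :=
        Finset.sum_le_sum fun y'' _ => hterm y''
    _ = (∑ y'' : g.Site, N y y'' * Real.exp (ρ * g.dist y y'')) * (κ * a₀ * Real.exp (-(ρ * g.dist y y'))) := by
        rw [Finset.sum_mul]
    _ ≤ M * (κ * a₀ * Real.exp (-(ρ * g.dist y y'))) :=
        mul_le_mul_of_nonneg_right (h y) (mul_nonneg (mul_nonneg hκ ha) (Real.exp_nonneg _))
    _ = κ * M * a₀ * Real.exp (-(ρ * g.dist y y')) := by ring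

/-! ## 2. Block majorants in the weighted norm -/

variable {F₁ F₂ F₃ : Type} [AddCommGroup F₁] [Module ℝ F₁] [AddCommGroup F₂] [Module ℝ F₂]
  [AddCommGroup F₃] [Module ℝ F₃]

/-- Composition of a weighted-norm majorant (left) with a rate-ρ exponential majorant (right): T₁T₂ has majorant
κ₂Ma·e^{−ρd}.  This is `B11SectG.hasMaj_comp_exp` with the row sum replaced by the weighted norm of T₁'s kernel — the
rate ρ is NOT lowered. [cite: Balaban1984PropagatorsII, (2.52)–(2.55) pp.232–233] -/
theorem hasMaj_comp_wrow {b₁ : BlockNorm g F₁} {b₂ : BlockNorm g F₂} {b₃ : BlockNorm g F₃}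
    {T₁ : F₂ →ₗ[ℝ] F₃} {T₂ : F₁ →ₗ[ℝ] F₂} {N : g.Site → g.Site → ℝ} {M a₀ ρ : ℝ}
    (htri : Triangle254 g) (hρ : 0 ≤ ρ) (ha : 0 ≤ a₀) (hN : ∀ x y, 0 ≤ N x y) (hM : WRow g ρ N M)
    (h₁ : HasMaj b₂ b₃ T₁ N)
    (h₂ : HasMaj b₁ b₂ T₂ (fun a b => a₀ * Real.exp (-(ρ * g.dist a b)))) :
    HasMaj b₁ b₃ (T₁ ∘ₗ T₂) (fun a b => b₂.κ * M * a₀ * Real.exp (-(ρ * g.dist a b))) :=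
  (hasMaj_comp h₁ h₂ hN).mono fun y y' => conv_wrow_exp htri hρ b₂.κ_nonneg ha hN hM y y'

/-- The weighted norm of the majorant of a composition T₁T₂ (kernels N₁, N₂): ‖N₁ ∗_{κ₂} N₂‖_ρ ≤ κ₂M₁M₂ — packaged
with `hasMaj_comp`. [cite: Balaban1984PropagatorsII, (2.52)–(2.55) pp.232–233] -/
theorem hasMaj_comp_wrow_wrow {b₁ : BlockNorm g F₁} {b₂ : BlockNorm g F₂} {b₃ : BlockNorm g F₃}
    {T₁ : F₂ →ₗ[ℝ] F₃} {T₂ : F₁ →ₗ[ℝ] F₂} {N₁ N₂ : g.Site → g.Site → ℝ} {M₁ M₂ ρ : ℝ}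
    (htri : Triangle254 g) (hρ : 0 ≤ ρ) (hN₁ : ∀ x y, 0 ≤ N₁ x y) (hN₂ : ∀ x y, 0 ≤ N₂ x y) (hM₂ : 0 ≤ M₂)
    (hM₁ : WRow g ρ N₁ M₁) (hM₂' : WRow g ρ N₂ M₂)
    (h₁ : HasMaj b₂ b₃ T₁ N₁) (h₂ : HasMaj b₁ b₂ T₂ N₂) :
    ∃ N : g.Site → g.Site → ℝ, (∀ a b, 0 ≤ N a b) ∧ WRow g ρ N (b₂.κ * M₁ * M₂) ∧ HasMaj b₁ b₃ (T₁ ∘ₗ T₂) N :=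
  ⟨fun a b => ∑ y'' : g.Site, N₁ a y'' * (b₂.κ * N₂ y'' b),
    fun _ _ => Finset.sum_nonneg fun _ _ => mul_nonneg (hN₁ _ _) (mul_nonneg b₂.κ_nonneg (hN₂ _ _)),
    wrow_conv htri hρ b₂.κ_nonneg hN₁ hN₂ hM₂ hM₁ hM₂', hasMaj_comp h₁ h₂ hN₁⟩

/-! ## 3. The Neumann series (3.130) / (188) in the weighted norm -/

/-- **NEUMANN SERIES, WEIGHTED-NORM FORM, KERNEL-CHECKED.**  Let 𝔄₀ : F₁ → F₂ satisfy 𝔄₀ = S + K′𝔄₀ (the fixed-point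
form of (3.130): K′ = G₀Δ′_π, S = G₀F), where K′ has a majorant N with WEIGHTED NORM ‖N‖_ρ ≤ m, S has majorant Ae^{−ρd},
and 𝔄₀ is a priori bounded (constant majorant M₀ — the finite lattice).  If q := κ₂m < 1 then 𝔄₀ has the majorant
A(1 − q)⁻¹e^{−ρd(y,y′)} — at the SAME rate ρ as S: the n-th term K′ⁿS has majorant qⁿAe^{−ρd} by n applications of
`conv_wrow_exp` (triangle inequality only), the remainder K′ᴺ𝔄₀ has the constant majorant qᴺM₀ → 0.
Compare `B11SectG.neumann_majorant`, where K′ = θe^{−δd} and the row sum is used at every step (ρ + σ ≤ δ, q = κθc):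
that statement is the special case checked by the `example` below.
[cite: Balaban1985BackgroundPropagators, (3.130) p.421; Balaban1985Variational, (188) p.308;
Balaban1984PropagatorsII, (2.54) p.233] -/
theorem neumann_majorant_wrow {b₁ : BlockNorm g F₁} {b₂ : BlockNorm g F₂} {K' : Module.End ℝ F₂}
    {S A0 : F₁ →ₗ[ℝ] F₂} {N : g.Site → g.Site → ℝ} {m A M₀ ρ : ℝ}
    (htri : Triangle254 g) (hd : ∀ a b : g.Site, 0 ≤ g.dist a b) (hρ : 0 ≤ ρ) (hN : ∀ x y, 0 ≤ N x y)
    (hm : WRow g ρ N m) (hA : 0 ≤ A) (hM₀ : 0 ≤ M₀)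
    (hK : HasMaj b₂ b₂ K' N)
    (hS : HasMaj b₁ b₂ S (fun a b => A * Real.exp (-(ρ * g.dist a b))))
    (hfix : A0 = S + K' ∘ₗ A0) (hap : HasMaj b₁ b₂ A0 (fun _ _ => M₀))
    (hq : b₂.κ * m < 1) :
    HasMaj b₁ b₂ A0 (fun a b => A * (1 - b₂.κ * m)⁻¹ * Real.exp (-(ρ * g.dist a b))) := by
  set q : ℝ := b₂.κ * m with hqdef
  intro y' μ hμ y
  have hm0 : 0 ≤ m := hm.nonneg hN y
  have hq0 : 0 ≤ q := mul_nonneg b₂.κ_nonneg hm0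
  -- (1) the n-th term K′ⁿS has majorant qⁿAe^{−ρd}: rate ρ preserved at every step
  have hterm : ∀ n : ℕ, HasMaj b₁ b₂ ((K' ^ n) ∘ₗ S)
      (fun a b => q ^ n * A * Real.exp (-(ρ * g.dist a b))) := by
    intro n
    induction n with
    | zero =>
        refine hS.congr ?_ |>.mono ?_
        · intro ν; simp
        · intro a b; simp
    | succ n ih =>
        have hstep := hasMaj_comp_wrow (b₁ := b₁) (b₂ := b₂) (b₃ := b₂) (T₁ := K') (T₂ := (K' ^ n) ∘ₗ S)
          htri hρ (mul_nonneg (pow_nonneg hq0 n) hA) hN hm hK ih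
        refine (hstep.congr fun ν => ?_).mono fun a b => ?_
        · simp [pow_succ', Module.End.mul_apply]
        · rw [hqdef]; ring_nf; exact le_refl _
  -- (2) partial sums
  have hpartial : ∀ Nn : ℕ, HasMaj b₁ b₂ (∑ n ∈ Finset.range Nn, (K' ^ n) ∘ₗ S)
      (fun a b => ∑ n ∈ Finset.range Nn, q ^ n * A * Real.exp (-(ρ * g.dist a b))) := fun Nn =>
    hasMaj_sum (fun n => (K' ^ n) ∘ₗ S) _ hterm Nn
  -- (3) the remainder K′ᴺ𝔄₀ has the constant majorant qᴺM₀ (pointwise bound N ≤ m, then the weighted row sum at ρ ≥ 0)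
  have hrem : ∀ Nn : ℕ, HasMaj b₁ b₂ ((K' ^ Nn) ∘ₗ A0) (fun _ _ => q ^ Nn * M₀) := by
    intro Nn
    induction Nn with
    | zero =>
        refine hap.congr ?_ |>.mono ?_
        · intro ν; simp
        · intro a b; simp
    | succ Nn ih =>
        have hstep := hasMaj_comp (b₁ := b₁) (b₂ := b₂) (b₃ := b₂) (T₁ := K') (T₂ := (K' ^ Nn) ∘ₗ A0) hK ih hN
        refine (hstep.congr fun ν => ?_).mono fun a b => ?_
        · simp [pow_succ', Module.End.mul_apply]
        · -- Σ_{y″} N(a,y″)·κ·qᴺM₀ ≤ κ m qᴺ M₀ since e^{ρd} ≥ 1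
          have hrow : ∑ y'' : g.Site, N a y'' ≤ m := by
            refine le_trans (Finset.sum_le_sum fun y'' _ => ?_) (hm a)
            have h1 : (1 : ℝ) ≤ Real.exp (ρ * g.dist a y'') :=
              Real.one_le_exp (mul_nonneg hρ (hd a y''))
            calc N a y'' = N a y'' * 1 := (mul_one _).symm
              _ ≤ N a y'' * Real.exp (ρ * g.dist a y'') := mul_le_mul_of_nonneg_left h1 (hN _ _)
          calc ∑ y'' : g.Site, N a y'' * (b₂.κ * (q ^ Nn * M₀))
              = (∑ y'' : g.Site, N a y'') * (b₂.κ * (q ^ Nn * M₀)) := by rw [Finset.sum_mul]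
            _ ≤ m * (b₂.κ * (q ^ Nn * M₀)) :=
                mul_le_mul_of_nonneg_right hrow (mul_nonneg b₂.κ_nonneg (mul_nonneg (pow_nonneg hq0 Nn) hM₀))
            _ = q ^ (Nn + 1) * M₀ := by rw [hqdef]; ring
  -- (4) for every N: loc y (𝔄₀μ) ≤ C + qᴺ M₀ loc y′ μ
  set C : ℝ := A * (1 - q)⁻¹ * Real.exp (-(ρ * g.dist y y')) * b₁.loc y' μ with hC
  have hgeomC : ∀ Nn : ℕ,
      (∑ n ∈ Finset.range Nn, q ^ n * A * Real.exp (-(ρ * g.dist y y'))) * b₁.loc y' μ ≤ C := by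
    intro Nn
    have hgeom : ∑ n ∈ Finset.range Nn, q ^ n ≤ (1 - q)⁻¹ :=
      sum_le_hasSum (Finset.range Nn) (fun n _ => pow_nonneg hq0 n) (hasSum_geometric_of_lt_one hq0 hq)
    have hnn : 0 ≤ A * Real.exp (-(ρ * g.dist y y')) * b₁.loc y' μ :=
      mul_nonneg (mul_nonneg hA (Real.exp_nonneg _)) (b₁.loc_nonneg _ _)
    calc (∑ n ∈ Finset.range Nn, q ^ n * A * Real.exp (-(ρ * g.dist y y'))) * b₁.loc y' μ
        = (∑ n ∈ Finset.range Nn, q ^ n) * (A * Real.exp (-(ρ * g.dist y y')) * b₁.loc y' μ) := by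
          rw [Finset.sum_mul, Finset.sum_mul]; exact Finset.sum_congr rfl fun n _ => by ring
      _ ≤ (1 - q)⁻¹ * (A * Real.exp (-(ρ * g.dist y y')) * b₁.loc y' μ) :=
          mul_le_mul_of_nonneg_right hgeom hnn
      _ = C := by rw [hC]; ring
  have hall : ∀ Nn : ℕ, b₂.loc y (A0 μ) ≤ C + q ^ Nn * M₀ * b₁.loc y' μ := by
    intro Nn
    have hdec := neumann_telescope hfix Nn μ
    have hsum_apply : (∑ n ∈ Finset.range Nn, (K' ^ n) ∘ₗ S) μ = ∑ n ∈ Finset.range Nn, (K' ^ n) (S μ) := by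
      simp [LinearMap.sum_apply]
    rw [hdec, ← hsum_apply]
    refine (b₂.loc_add_le y _ _).trans ?_
    have h1 := hpartial Nn y' μ hμ y
    have h2 := hrem Nn y' μ hμ y
    simp only [LinearMap.comp_apply] at h2
    linarith [hgeomC Nn]
  -- (5) let N → ∞: qᴺ → 0
  have hlim : Filter.Tendsto (fun Nn : ℕ => C + q ^ Nn * M₀ * b₁.loc y' μ) Filter.atTop (nhds (C + 0 * M₀ * b₁.loc y' μ)) := by
    refine Filter.Tendsto.add tendsto_const_nhds ?_
    exact (tendsto_pow_atTop_nhds_zero_of_lt_one hq0 hq).mul_const M₀ |>.mul_const _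
  have hle : b₂.loc y (A0 μ) ≤ C + 0 * M₀ * b₁.loc y' μ :=
    ge_of_tendsto hlim (Filter.Eventually.of_forall hall)
  simpa [hC] using hle

/-! `B11SectG.neumann_majorant` RECOVERED from the weighted-norm lemma (stated as an `example`, not a theorem: the
landed declaration is the one to cite): K′ = θe^{−δd}, ρ + σ ≤ δ, row sum at σ with constant c ⇒ m = θc and q = κθc —
same hypotheses, same conclusion. So the weighted-norm form is a strict generalisation.
[cite: Balaban1985Variational, (187)–(190) p.308] -/
example {b₁ : BlockNorm g F₁} {b₂ : BlockNorm g F₂} {K' : Module.End ℝ F₂}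
    {S A0 : F₁ →ₗ[ℝ] F₂} {θ A M₀ δ ρ σ c : ℝ}
    (htri : Triangle254 g) (hd : ∀ a b : g.Site, 0 ≤ g.dist a b) (hrow : RowSum g σ c)
    (hθ : 0 ≤ θ) (hA : 0 ≤ A) (hM₀ : 0 ≤ M₀) (hρ : 0 ≤ ρ) (hρδ : ρ + σ ≤ δ)
    (hK : HasMaj b₂ b₂ K' (fun a b => θ * Real.exp (-(δ * g.dist a b))))
    (hS : HasMaj b₁ b₂ S (fun a b => A * Real.exp (-(ρ * g.dist a b))))
    (hfix : A0 = S + K' ∘ₗ A0) (hap : HasMaj b₁ b₂ A0 (fun _ _ => M₀))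
    (hq : b₂.κ * θ * c < 1) :
    HasMaj b₁ b₂ A0 (fun a b => A * (1 - b₂.κ * θ * c)⁻¹ * Real.exp (-(ρ * g.dist a b))) := by
  have hm := wrow_of_exp (g := g) hd hrow hθ hρδ
  have := neumann_majorant_wrow htri hd hρ (fun a b => mul_nonneg hθ (Real.exp_nonneg _)) hm hA hM₀ hK hS hfix hap
    (by rw [← mul_assoc]; exact hq)
  refine this.mono fun a b => le_of_eq ?_
  rw [mul_assoc b₂.κ θ c]

/-! ## 4. Sect. D (3.130): the right entries GF with ONE rate loss -/

section SectD

variable {F₀ F : Type} [AddCommGroup F₀] [Module ℝ F₀] [AddCommGroup F] [Module ℝ F]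

/-- **RIGHT ENTRIES OF (3.46) FOR G, WITH DECAY — ONE RATE LOSS.**  Same hypotheses as
`B9SectDL2Decay.rightEntry_majorant` except ρ + σ ≤ δ₁ (instead of ρ + 2σ ≤ δ₁): G₀ (majorant Be^{−δ₁d}, b₁ → b₂)
and T′ = Δ′_π (θe^{−δ₁d}, b₂ → b₁) each have weighted norm ≤ Bc resp. θc at the rate ρ, so K′ = G₀T′ has
‖·‖_ρ ≤ κ₁Bθc² (`wrow_conv`), and the Neumann series keeps the rate ρ (`neumann_majorant_wrow`):
GF has majorant A(1 − q)⁻¹e^{−ρd} with q = κ₂(κ₁Bθc)c.  The constant is the SAME as in the landed module (the power c²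
is forced: each of G₀, T′ needs the row sum once to be measured in ‖·‖_ρ); the gain is the rate.  KERNEL-CHECKED.
[cite: Balaban1985BackgroundPropagators, (3.130) p.421 + Thm 3.12 p.423; Balaban1984PropagatorsII, Lemma 2.1 p.234] -/
theorem rightEntry_majorant_wrow {b₀ : BlockNorm g F₀} {b₁ b₂ : BlockNorm g F} {G G0 T' : Module.End ℝ F}
    {Fop : F₀ →ₗ[ℝ] F} {B θ A M₀ δ₁ ρ σ c : ℝ}
    (htri : Triangle254 g) (hd : ∀ a b : g.Site, 0 ≤ g.dist a b) (hrow : RowSum g σ c)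
    (hB : 0 ≤ B) (hθ : 0 ≤ θ) (hA : 0 ≤ A) (hM₀ : 0 ≤ M₀) (hρ : 0 ≤ ρ) (hσ : 0 ≤ σ) (hρδ : ρ + σ ≤ δ₁)
    (hG0 : HasMaj b₁ b₂ G0 (fun a b => B * Real.exp (-(δ₁ * g.dist a b))))
    (hT' : HasMaj b₂ b₁ T' (fun a b => θ * Real.exp (-(δ₁ * g.dist a b))))
    (hS : HasMaj b₀ b₂ (G0 ∘ₗ Fop) (fun a b => A * Real.exp (-(δ₁ * g.dist a b))))
    (hfix : G = G0 + G0 * T' * G)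
    (hap : HasMaj b₀ b₂ (G ∘ₗ Fop) (fun _ _ => M₀))
    (hq : b₂.κ * (b₁.κ * B * θ * c) * c < 1) :
    HasMaj b₀ b₂ (G ∘ₗ Fop)
      (fun a b => A * (1 - b₂.κ * (b₁.κ * B * θ * c) * c)⁻¹ * Real.exp (-(ρ * g.dist a b))) := by
  intro y' μ hμ y
  have hc : 0 ≤ c := hrow.nonneg y
  -- weighted norms of the two factors at the rate ρ
  have hwG : WRow g ρ (fun a b => B * Real.exp (-(δ₁ * g.dist a b))) (B * c) := wrow_of_exp hd hrow hB hρδ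
  have hwT : WRow g ρ (fun a b => θ * Real.exp (-(δ₁ * g.dist a b))) (θ * c) := wrow_of_exp hd hrow hθ hρδ
  -- K′ = G₀T′: majorant = convolution kernel, weighted norm ≤ κ₁(Bc)(θc)
  have hNG : ∀ a b, 0 ≤ B * Real.exp (-(δ₁ * g.dist a b)) := fun a b => mul_nonneg hB (Real.exp_nonneg _)
  have hNT : ∀ a b, 0 ≤ θ * Real.exp (-(δ₁ * g.dist a b)) := fun a b => mul_nonneg hθ (Real.exp_nonneg _)
  have hK : HasMaj b₂ b₂ (G0 ∘ₗ T') (fun a b => ∑ y'' : g.Site,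
      B * Real.exp (-(δ₁ * g.dist a y'')) * (b₁.κ * (θ * Real.exp (-(δ₁ * g.dist y'' b))))) :=
    hasMaj_comp hG0 hT' hNG
  have hNK : ∀ a b, 0 ≤ ∑ y'' : g.Site,
      B * Real.exp (-(δ₁ * g.dist a y'')) * (b₁.κ * (θ * Real.exp (-(δ₁ * g.dist y'' b)))) :=
    fun a b => Finset.sum_nonneg fun y'' _ => mul_nonneg (hNG _ _) (mul_nonneg b₁.κ_nonneg (hNT _ _))
  have hwK : WRow g ρ (fun a b => ∑ y'' : g.Site,
      B * Real.exp (-(δ₁ * g.dist a y'')) * (b₁.κ * (θ * Real.exp (-(δ₁ * g.dist y'' b)))))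
      (b₁.κ * (B * c) * (θ * c)) :=
    wrow_conv htri hρ b₁.κ_nonneg hNG hNT (mul_nonneg hθ hc) hwG hwT
  have hS' : HasMaj b₀ b₂ (G0 ∘ₗ Fop) (fun a b => A * Real.exp (-(ρ * g.dist a b))) :=
    hS.of_rate_le hd hA (by linarith)
  have hmain := neumann_majorant_wrow htri hd hρ hNK hwK hA hM₀ hK hS' (rightEntry_fix Fop hfix) hap
    (by calc b₂.κ * (b₁.κ * (B * c) * (θ * c)) = b₂.κ * (b₁.κ * B * θ * c) * c := by ring
          _ < 1 := hq)
  have := hmain y' μ hμ y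
  calc b₂.loc y ((G ∘ₗ Fop) μ)
      ≤ A * (1 - b₂.κ * (b₁.κ * (B * c) * (θ * c)))⁻¹ * Real.exp (-(ρ * g.dist y y')) * b₀.loc y' μ := this
    _ = A * (1 - b₂.κ * (b₁.κ * B * θ * c) * c)⁻¹ * Real.exp (-(ρ * g.dist y y')) * b₀.loc y' μ := by
        ring_nf

/-- The variant behind the reader's toy (G-A21-1 (ii), G₀ = I): if G₀ carries its OWN weighted-norm bound
‖N_{G₀}‖_ρ ≤ m_G (e.g. m_G = 1 for G₀ = I, or any bound obtained without the row sum), then q = κ₂κ₁m_Gθc — ONE factor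
c.  This, not `rightEntry_majorant_wrow`, is the statement «q ∝ c» of G-A21-1 (ii); from the exponential majorant of
G₀ alone one gets m_G = Bc and the c² of `rightEntry_majorant_wrow` (G-A22-1). KERNEL-CHECKED.
[cite: Balaban1985BackgroundPropagators, (3.130) p.421; Balaban1984PropagatorsII, Lemma 2.1 p.234] -/
theorem rightEntry_majorant_wrow' {b₀ : BlockNorm g F₀} {b₁ b₂ : BlockNorm g F} {G G0 T' : Module.End ℝ F}
    {Fop : F₀ →ₗ[ℝ] F} {NG : g.Site → g.Site → ℝ} {mG θ A M₀ δ₁ ρ σ c : ℝ}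
    (htri : Triangle254 g) (hd : ∀ a b : g.Site, 0 ≤ g.dist a b) (hrow : RowSum g σ c)
    (hNG : ∀ x y, 0 ≤ NG x y) (hmG : WRow g ρ NG mG)
    (hθ : 0 ≤ θ) (hA : 0 ≤ A) (hM₀ : 0 ≤ M₀) (hρ : 0 ≤ ρ) (hρδ : ρ + σ ≤ δ₁)
    (hG0 : HasMaj b₁ b₂ G0 NG)
    (hT' : HasMaj b₂ b₁ T' (fun a b => θ * Real.exp (-(δ₁ * g.dist a b))))
    (hS : HasMaj b₀ b₂ (G0 ∘ₗ Fop) (fun a b => A * Real.exp (-(ρ * g.dist a b))))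
    (hfix : G = G0 + G0 * T' * G)
    (hap : HasMaj b₀ b₂ (G ∘ₗ Fop) (fun _ _ => M₀))
    (hq : b₂.κ * (b₁.κ * mG * (θ * c)) < 1) :
    HasMaj b₀ b₂ (G ∘ₗ Fop)
      (fun a b => A * (1 - b₂.κ * (b₁.κ * mG * (θ * c)))⁻¹ * Real.exp (-(ρ * g.dist a b))) := by
  have hc : ∀ y : g.Site, 0 ≤ c := fun y => hrow.nonneg y
  have hwT : WRow g ρ (fun a b => θ * Real.exp (-(δ₁ * g.dist a b))) (θ * c) := wrow_of_exp hd hrow hθ hρδ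
  have hNT : ∀ a b, 0 ≤ θ * Real.exp (-(δ₁ * g.dist a b)) := fun a b => mul_nonneg hθ (Real.exp_nonneg _)
  have hK : HasMaj b₂ b₂ (G0 ∘ₗ T') (fun a b => ∑ y'' : g.Site,
      NG a y'' * (b₁.κ * (θ * Real.exp (-(δ₁ * g.dist y'' b))))) := hasMaj_comp hG0 hT' hNG
  have hNK : ∀ a b, 0 ≤ ∑ y'' : g.Site, NG a y'' * (b₁.κ * (θ * Real.exp (-(δ₁ * g.dist y'' b)))) :=
    fun a b => Finset.sum_nonneg fun y'' _ => mul_nonneg (hNG _ _) (mul_nonneg b₁.κ_nonneg (hNT _ _))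
  intro y' μ hμ y
  have hwK : WRow g ρ (fun a b => ∑ y'' : g.Site, NG a y'' * (b₁.κ * (θ * Real.exp (-(δ₁ * g.dist y'' b)))))
      (b₁.κ * mG * (θ * c)) :=
    wrow_conv htri hρ b₁.κ_nonneg hNG hNT (mul_nonneg hθ (hc y)) hmG hwT
  exact neumann_majorant_wrow htri hd hρ hNK hwK hA hM₀ hK hS (rightEntry_fix Fop hfix) hap hq y' μ hμ y

end SectD

end Literature.MathematicalPhysics.QuantumFieldTheory.Balaban1983to89.B9SectDWeightedNeumann
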